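import Summits.ValiantsHypothesis.ValiantsHypothesis.Theorems.NewtonFramesTwoProductsFrameRungTwoGenericBlocks
import Summits.ValiantsHypothesis.ValiantsHypothesis.Theorems.NewtonFramesTwoProductsFrameRungTwoRainbowBlocks

/-!
# Crux `TwoProducts` (stmt-5906), line `FrameRungTwo`: the shallow-neighbour lemma (IX) for a GENERIC member frame

`shallowNeighbour_of_generic`: the hypothesis `hIX` of `crossCancel_of_shallowNeighbour` (`…FrameRungTwoShallowNeighbour.lean`,
p603280) — verbatim binder list, verbatim conclusion — DISCHARGED for every vertex whose MEMBER frame `f` satisfies the genericity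
condition `hgen` of `…FrameRungTwoGenericBlocks.lean` ("gap multisets of `f` relative to the tops have unique sums"; it implies g2's
no-parallelogram condition on `f`), the non-member frame `g` being an ARBITRARY dissociated frame (carries allowed) and the
coefficients arbitrary.  Moreover the conclusion holds in the strong form: the `g`-word demotes ONE letter (of the coordinate `p` of
the extra gap `T' p − y`) — un-demoting the `l`-lightest letter of the vertex word gives a common point of `g`-depth `1`.
Proof = the block theorem of the memo `Cruxes/TwoProducts/memo-IX-blocks.md`: blocks of the demotion set (`hBk`), (A1∃) and (A1!)
from `…GenericBlocks.lean`, (A2) with coefficients from `…BlockPartition.lean` (p610177), the lightest demoted letter is monochromatic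
(`mono_of_generic`, the 2-letter `g`-word `{γ_F, γ_{j₀}}` would be an `f`-word demoting `j₀` twice), and the combinatorial engine
`complementary_pair_of_mono` of `…RainbowBlocks.lean` (p609099).
What is NOT here: (IX) for member frames WITH additive coincidences (AP letters, parallelograms inside one coordinate) — open; see the
memo (faithful model: no counterexample in > 6·10⁵ instances).  Honest scope: the generic-member case of ONE hypothesis of ONE stub of a
rung strictly below the crux `TwoProducts`; for the `k = 2` COUNT both frames would need `hgen`, which is no gain over g2's
no-parallelogram count; nothing here bears on `VP ≠ VNP`. [ours; setting KPTT arXiv:1308.2286 §2, §5]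
-/

set_option linter.dupNamespace false

namespace Summit.ValiantsHypothesis.ValiantsHypothesis.Theorems.NewtonFramesTwoProducts.FrameRungTwoTrinomial

open MvPolynomial
open scoped BigOperators Classical
open Summit.ValiantsHypothesis.Theorems.DissociatedFixedK (lexKey lexKey_injective)
open Summit.ValiantsHypothesis.ValiantsHypothesis.Theorems.DissociatedFixedK.Negative (emb emb_injective)
open Summit.ValiantsHypothesis.ValiantsHypothesis.Theorems.NewtonFramesTwoProducts.FrameRungTwoBinomial
  (emb_add emb_sum apply_le_of_lexKey_le eq_T_of_not_mem_filter ne_T_of_mem_filter coeff_word exists_word prod_coeff_ne_zero)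
open Summit.ValiantsHypothesis.ValiantsHypothesis.Theorems.NewtonFramesTwoProducts.FrameRungTwoBlocks (complementary_pair_of_mono
  singleton_mem_of_rainbowBelow)

noncomputable section

section GenericShallow

variable {m : ℕ}

/-- **The lightest demoted letter is monochromatic (generic member frame).**  If no `g`-word demoting ≤ 2 letters has sum `e`, then
every block through a demoted coordinate `j₀` of minimal gap weight `l (T j₀) − l (a j₀)` has the colour of the block `{j₀}`:
otherwise the 2-letter `g`-word `{γ_F, γ_{j₀}}` is key-above `e`, hence an `f`-word, demoting `j₀` twice — excluded by `hgen`. [ours] -/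
theorem mono_of_generic (l : (Fin 2 → ℝ) →L[ℝ] ℝ) (f g : Fin m → MvPolynomial (Fin 2) ℂ) (T T' : Fin m → (Fin 2 →₀ ℕ))
    (hT : ∀ j, T j ∈ (f j).support) (hTmax : ∀ j, ∀ x ∈ (f j).support, lexKey l x ≤ lexKey l (T j))
    (hT' : ∀ j, T' j ∈ (g j).support)
    (hinjf : ∀ a b : Fin m → (Fin 2 →₀ ℕ), (∀ j, a j ∈ (f j).support) → (∀ j, b j ∈ (f j).support) →
      ∑ j, a j = ∑ j, b j → a = b)
    (hinjg : ∀ a b : Fin m → (Fin 2 →₀ ℕ), (∀ j, a j ∈ (g j).support) → (∀ j, b j ∈ (g j).support) →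
      ∑ j, a j = ∑ j, b j → a = b)
    (e : Fin 2 →₀ ℕ)
    (hzero : ∀ x : Fin 2 →₀ ℕ, x ≠ e → l (emb e) ≤ l (emb x) → coeff x (∏ j, f j) + coeff x (∏ j, g j) = 0)
    (htop : ∑ j, T j = ∑ j, T' j)
    {a : Fin m → (Fin 2 →₀ ℕ)} (ha : ∀ j, a j ∈ (f j).support) (hea : ∑ j, a j = e)
    (hgen : ∀ (s : Finset (Fin m)) (bs : Fin m → Fin m → (Fin 2 →₀ ℕ)) (b : Fin m → (Fin 2 →₀ ℕ)),
      (∀ i ∈ s, ∀ j, bs i j ∈ (f j).support) → (∀ j, b j ∈ (f j).support) →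
      ∑ i ∈ s, ∑ j, (emb (T j) - emb (bs i j)) = ∑ j, (emb (T j) - emb (b j)) →
      ∀ j, (b j = T j → ∀ i ∈ s, bs i j = T j) ∧ (b j ≠ T j → ∃ i ∈ s, bs i j = b j ∧ ∀ i' ∈ s, bs i' j ≠ T j → i' = i))
    (hno : ∀ w : Fin m → (Fin 2 →₀ ℕ), (∀ i, w i ∈ (g i).support) → (Finset.univ.filter fun i => w i ≠ T' i).card ≤ 2 →
      ∑ i, w i ≠ e)
    (Bk : Finset (Finset (Fin m))) (κ : Finset (Fin m) → Fin m) (yv : Finset (Fin m) → (Fin 2 →₀ ℕ))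
    (hκ : ∀ F ∈ Bk, yv F ∈ (g (κ F)).support ∧ yv F ≠ T' (κ F) ∧
      ∑ j ∈ F, (emb (T j) - emb (a j)) = emb (T' (κ F)) - emb (yv F))
    {j₀ : Fin m} (hj₀ : j₀ ∈ Finset.univ.filter fun i => a i ≠ T i)
    (hmin : ∀ j ∈ Finset.univ.filter (fun i => a i ≠ T i), l (emb (T j₀)) - l (emb (a j₀)) ≤ l (emb (T j)) - l (emb (a j)))
    (hj₀B : {j₀} ∈ Bk) :
    ∀ F ∈ Bk, F ⊂ Finset.univ.filter (fun i => a i ≠ T i) → j₀ ∈ F → κ F = κ {j₀} := by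
  intro F hF hFJ hjF
  by_contra hcol
  obtain ⟨hy, hyT, hgapF⟩ := hκ F hF
  obtain ⟨hy₀, hy₀T, hgap₀⟩ := hκ {j₀} hj₀B
  rw [Finset.sum_singleton] at hgap₀
  -- the two-letter `g`-word
  set u : Fin m → (Fin 2 →₀ ℕ) := Function.update (Function.update T' (κ F) (yv F)) (κ {j₀}) (yv {j₀}) with hu
  have hcol' : κ F ≠ κ {j₀} := hcol
  have humem : ∀ i, u i ∈ (g i).support := by
    intro i
    rcases eq_or_ne i (κ {j₀}) with rfl | hi
    · rw [hu, Function.update_self]; exact hy₀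
    · rw [hu, Function.update_of_ne hi]
      rcases eq_or_ne i (κ F) with rfl | hi'
      · rw [Function.update_self]; exact hy
      · rw [Function.update_of_ne hi']; exact hT' i
  have husum : emb (∑ i, u i) = emb (∑ j, T j) - ∑ j ∈ F, (emb (T j) - emb (a j)) - (emb (T j₀) - emb (a j₀)) := by
    rw [hu, emb_sum_update_update T' hcol', ← htop, ← hgapF, ← hgap₀]
  have hcard : (Finset.univ.filter fun i => u i ≠ T' i).card ≤ 2 := by
    calc (Finset.univ.filter fun i => u i ≠ T' i).card ≤ ({κ F, κ {j₀}} : Finset (Fin m)).card := by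
          refine Finset.card_le_card fun i hi => ?_
          rw [Finset.mem_filter] at hi
          rw [Finset.mem_insert, Finset.mem_singleton]
          by_contra hno'
          push Not at hno'
          apply hi.2
          rw [hu, Function.update_of_ne hno'.2, Function.update_of_ne hno'.1]
      _ ≤ 2 := Finset.card_le_two
  -- it is key-above `e`
  have hw0 : ∀ j, 0 ≤ l (emb (T j)) - l (emb (a j)) := fun j => sub_nonneg.2 (apply_le_of_lexKey_le l (hTmax j _ (ha j)))
  obtain ⟨k, hkJ, hkF⟩ := Finset.exists_of_ssubset hFJ
  have hle : l (emb e) ≤ l (emb (∑ i, u i)) := by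
    have he' : emb e = emb (∑ j, T j) - ∑ j ∈ Finset.univ.filter (fun i => a i ≠ T i), (emb (T j) - emb (a j)) := by
      rw [← hea, emb_sum_eq T a, sum_gap_eq_sum_filter T a]
    rw [he', husum, map_sub, map_sub, map_sub, map_sum, map_sum]
    have hsplit := Finset.sum_filter_add_sum_filter_not (Finset.univ.filter fun i => a i ≠ T i) (fun j => j ∈ F)
      (fun j => l (emb (T j) - emb (a j)))
    have hF' : (Finset.univ.filter fun i => a i ≠ T i).filter (fun j => j ∈ F) = F := by
      ext j; simp only [Finset.mem_filter, Finset.mem_univ, true_and]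
      exact ⟨fun h => h.2, fun h => ⟨ne_T_of_mem_filter T (hFJ.subset h), h⟩⟩
    rw [hF'] at hsplit
    have hk : k ∈ (Finset.univ.filter fun i => a i ≠ T i).filter (fun j => ¬ j ∈ F) := Finset.mem_filter.2 ⟨hkJ, hkF⟩
    have hrest : l (emb (T k) - emb (a k)) ≤
        ∑ j ∈ (Finset.univ.filter fun i => a i ≠ T i).filter (fun j => ¬ j ∈ F), l (emb (T j) - emb (a j)) := by
      apply Finset.single_le_sum (f := fun j => l (emb (T j) - emb (a j))) _ hk
      intro j _
      rw [map_sub]; exact hw0 j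
    have hk0 := hmin k hkJ
    rw [map_sub] at hrest ⊢
    linarith
  have hne : ∑ i, u i ≠ e := hno u humem hcard
  obtain ⟨v, hv, hvsum⟩ := common_fword_of_gword l f g hinjf hinjg e hzero humem hle hne
  -- genericity on the pair of corners `b^F`, `b^{j₀}` against `v`
  set cF : Fin m → (Fin 2 →₀ ℕ) := fun j => if j ∈ F then a j else T j with hcF
  set c0 : Fin m → (Fin 2 →₀ ℕ) := fun j => if j ∈ ({j₀} : Finset (Fin m)) then a j else T j with hc0
  set bs : Fin m → Fin m → (Fin 2 →₀ ℕ) := Function.update (fun _ => c0) (κ F) cF with hbs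
  have hcFmem : ∀ j, cF j ∈ (f j).support := by
    refine promote_mem f T hT ha fun j => ?_
    by_cases hj : j ∈ F
    · left; simp only [hcF, if_pos hj]
    · right; simp only [hcF, if_neg hj]
  have hc0mem : ∀ j, c0 j ∈ (f j).support := by
    refine promote_mem f T hT ha fun j => ?_
    by_cases hj : j ∈ ({j₀} : Finset (Fin m))
    · left; simp only [hc0, if_pos hj]
    · right; simp only [hc0, if_neg hj]
  have hbsF' : bs (κ F) = cF := by rw [hbs, Function.update_self]
  have hbs0' : bs (κ {j₀}) = c0 := by rw [hbs, Function.update_of_ne (Ne.symm hcol')]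
  have hbsmem : ∀ i ∈ ({κ F, κ {j₀}} : Finset (Fin m)), ∀ j, bs i j ∈ (f j).support := by
    intro i _ j
    rcases eq_or_ne i (κ F) with rfl | hi
    · rw [hbsF']; exact hcFmem j
    · rw [hbs, Function.update_of_ne hi]; exact hc0mem j
  have hgapbs : ∑ i ∈ ({κ F, κ {j₀}} : Finset (Fin m)), ∑ j, (emb (T j) - emb (bs i j)) =
      ∑ j, (emb (T j) - emb (v j)) := by
    rw [Finset.sum_pair hcol', hbsF', hbs0']
    have h1 : ∑ j, (emb (T j) - emb (cF j)) = ∑ j ∈ F, (emb (T j) - emb (a j)) := by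
      have hc : emb (∑ j, cF j) = emb (∑ j, T j) - ∑ j ∈ F, (emb (T j) - emb (a j)) := emb_sum_corner T a F
      have hs := emb_sum_eq T cF
      linear_combination hs - hc
    have h2 : ∑ j, (emb (T j) - emb (c0 j)) = emb (T j₀) - emb (a j₀) := by
      have hc : emb (∑ j, c0 j) = emb (∑ j, T j) - ∑ j ∈ ({j₀} : Finset (Fin m)), (emb (T j) - emb (a j)) :=
        emb_sum_corner T a {j₀}
      have hs := emb_sum_eq T c0
      rw [Finset.sum_singleton] at hc
      linear_combination hs - hc
    have h3 := emb_sum_eq T v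
    rw [hvsum, husum] at h3
    rw [h1, h2]
    linear_combination -h3
  have hG := (hgen {κ F, κ {j₀}} bs v hbsmem hv hgapbs j₀).2
  have hbsF : bs (κ F) j₀ = a j₀ := by rw [hbsF']; simp only [hcF, if_pos hjF]
  have hbs0 : bs (κ {j₀}) j₀ = a j₀ := by rw [hbs0']; simp [hc0]
  have haj₀ : a j₀ ≠ T j₀ := ne_T_of_mem_filter T hj₀
  by_cases hvj : v j₀ = T j₀
  · have := (hgen {κ F, κ {j₀}} bs v hbsmem hv hgapbs j₀).1 hvj (κ F) (by simp)
    rw [hbsF] at this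
    exact haj₀ this
  · obtain ⟨i, -, -, huniq⟩ := hG hvj
    have h1 := huniq (κ F) (by simp) (by rw [hbsF]; exact haj₀)
    have h2 := huniq (κ {j₀}) (by simp) (by rw [hbs0]; exact haj₀)
    exact hcol' (h1.trans h2.symm)

/-- **(IX) for a generic member frame** — the hypothesis `hIX` of `crossCancel_of_shallowNeighbour` (p603280), verbatim, discharged
under dissociation of both frames and the genericity `hgen` of the member frame `f` (no hypothesis on `g` beyond dissociation,
arbitrary coefficients).  [ours] -/
theorem shallowNeighbour_of_generic (lc : (Fin 2 → ℝ) →L[ℝ] ℝ) (f g : Fin m → MvPolynomial (Fin 2) ℂ)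
    (hinjf : ∀ a b : Fin m → (Fin 2 →₀ ℕ), (∀ j, a j ∈ (f j).support) → (∀ j, b j ∈ (f j).support) →
      ∑ j, a j = ∑ j, b j → a = b)
    (hinjg : ∀ a b : Fin m → (Fin 2 →₀ ℕ), (∀ j, a j ∈ (g j).support) → (∀ j, b j ∈ (g j).support) →
      ∑ j, a j = ∑ j, b j → a = b)
    (e : Fin 2 →₀ ℕ) (T T' a : Fin m → (Fin 2 →₀ ℕ))
    (hgen : ∀ (s : Finset (Fin m)) (bs : Fin m → Fin m → (Fin 2 →₀ ℕ)) (b : Fin m → (Fin 2 →₀ ℕ)),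
      (∀ i ∈ s, ∀ j, bs i j ∈ (f j).support) → (∀ j, b j ∈ (f j).support) →
      ∑ i ∈ s, ∑ j, (emb (T j) - emb (bs i j)) = ∑ j, (emb (T j) - emb (b j)) →
      ∀ j, (b j = T j → ∀ i ∈ s, bs i j = T j) ∧ (b j ≠ T j → ∃ i ∈ s, bs i j = b j ∧ ∀ i' ∈ s, bs i' j ≠ T j → i' = i))
    (hT : ∀ j, T j ∈ (f j).support) (hTmax : ∀ j, ∀ x ∈ (f j).support, lexKey lc x ≤ lexKey lc (T j))
    (hT' : ∀ j, T' j ∈ (g j).support) (hTmax' : ∀ j, ∀ x ∈ (g j).support, lexKey lc x ≤ lexKey lc (T' j))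
    (ha : ∀ j, a j ∈ (f j).support) (hae : ∑ j, a j = e)
    (hzero : ∀ x : Fin 2 →₀ ℕ, x ≠ e → lc (emb e) ≤ lc (emb x) → coeff x (∏ j, f j) + coeff x (∏ j, g j) = 0)
    (heF : coeff e (∏ j, f j) + coeff e (∏ j, g j) ≠ 0) (htop : ∑ j, T j = ∑ j, T' j)
    (hTe : lexKey lc e < lexKey lc (∑ j, T j)) :
    (Finset.univ.filter fun i => a i ≠ T i).card ≤ 3 ∨
      ∃ (w : Fin m → (Fin 2 →₀ ℕ)) (p : Fin m) (y : Fin 2 →₀ ℕ), (∀ i, w i ∈ (g i).support) ∧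
        (Finset.univ.filter fun i => w i ≠ T' i).card ≤ 2 ∧ y ∈ (g p).support ∧
        emb e = emb (∑ i, w i) - (emb (T' p) - emb y) := by
  by_cases hJ3 : (Finset.univ.filter fun i => a i ≠ T i).card ≤ 3
  · exact Or.inl hJ3
  right
  push Not at hJ3
  set J := Finset.univ.filter (fun i => a i ≠ T i) with hJ
  have hJ2 : 2 ≤ J.card := by omega
  have hJne : J.Nonempty := by rw [← Finset.card_pos]; omega
  -- the lightest demoted letter
  obtain ⟨j₀, hj₀, hmin⟩ := Finset.exists_min_image J (fun j => lc (emb (T j)) - lc (emb (a j))) hJne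
  by_contra hno'
  have hno : ∀ w : Fin m → (Fin 2 →₀ ℕ), (∀ i, w i ∈ (g i).support) →
      (Finset.univ.filter fun i => w i ≠ T' i).card ≤ 2 → ∑ i, w i ≠ e := by
    intro w hw hc hsum
    exact hno' ⟨w, j₀, T' j₀, hw, hc, hT' j₀, by rw [sub_self, sub_zero, hsum]⟩
  -- the blocks, their colours and letters
  set Bk : Finset (Finset (Fin m)) := J.powerset.filter fun F => F.Nonempty ∧ ∃ (p : Fin m) (y : Fin 2 →₀ ℕ),
    y ∈ (g p).support ∧ y ≠ T' p ∧ ∑ j ∈ F, (emb (T j) - emb (a j)) = emb (T' p) - emb y with hBkdef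
  have hBk : ∀ F, F ∈ Bk ↔ F ⊆ J ∧ F.Nonempty ∧ ∃ (p : Fin m) (y : Fin 2 →₀ ℕ),
      y ∈ (g p).support ∧ y ≠ T' p ∧ ∑ j ∈ F, (emb (T j) - emb (a j)) = emb (T' p) - emb y := by
    intro F
    rw [hBkdef, Finset.mem_filter, Finset.mem_powerset]
  set κ : Finset (Fin m) → Fin m := fun F => if h : ∃ (p : Fin m) (y : Fin 2 →₀ ℕ),
    y ∈ (g p).support ∧ y ≠ T' p ∧ ∑ j ∈ F, (emb (T j) - emb (a j)) = emb (T' p) - emb y then h.choose else j₀ with hκdef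
  set yv : Finset (Fin m) → (Fin 2 →₀ ℕ) := fun F => if h : ∃ (p : Fin m) (y : Fin 2 →₀ ℕ),
    y ∈ (g p).support ∧ y ≠ T' p ∧ ∑ j ∈ F, (emb (T j) - emb (a j)) = emb (T' p) - emb y then h.choose_spec.choose else 0
    with hyvdef
  have hκ : ∀ F ∈ Bk, yv F ∈ (g (κ F)).support ∧ yv F ≠ T' (κ F) ∧
      ∑ j ∈ F, (emb (T j) - emb (a j)) = emb (T' (κ F)) - emb (yv F) := by
    intro F hF
    obtain ⟨-, -, h⟩ := (hBk F).1 hF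
    simp only [hκdef, hyvdef, dif_pos h]
    exact h.choose_spec.choose_spec
  have hκ' : ∀ F ∈ Bk, ∃ y : Fin 2 →₀ ℕ, y ∈ (g (κ F)).support ∧ y ≠ T' (κ F) ∧
      ∑ j ∈ F, (emb (T j) - emb (a j)) = emb (T' (κ F)) - emb y := fun F hF => ⟨yv F, hκ F hF⟩
  have hBkJ : ∀ F ∈ Bk, F ⊆ J := fun F hF => ((hBk F).1 hF).1
  -- (A1)
  have hA1 : ∀ E, E ⊂ J → E.Nonempty → ∃ P : Finset (Finset (Fin m)), (P ⊆ Bk ∧ (∀ F ∈ P, F.Nonempty) ∧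
      (∀ F ∈ P, ∀ F' ∈ P, F ≠ F' → Disjoint F F') ∧ P.biUnion id = E ∧ ∀ F ∈ P, ∀ F' ∈ P, κ F = κ F' → F = F') ∧
      ∀ P' : Finset (Finset (Fin m)), (P' ⊆ Bk ∧ (∀ F ∈ P', F.Nonempty) ∧
        (∀ F ∈ P', ∀ F' ∈ P', F ≠ F' → Disjoint F F') ∧ P'.biUnion id = E ∧ ∀ F ∈ P', ∀ F' ∈ P', κ F = κ F' → F = F') →
        P' = P := by
    intro E hEJ _
    obtain ⟨P, hP⟩ := exists_rainbow_of_generic lc f g T T' hT hTmax hT' hTmax' hinjf hinjg e hzero htop ha hae hgen hno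
      Bk κ hBk hκ' E hEJ
    exact ⟨P, hP, fun P' hP' => rainbow_unique f g T T' hT hT' hinjf hinjg ha Bk κ yv hBkJ hκ E P P' hP hP'⟩
  -- (A2)
  have hA2 : ∀ P : Finset (Finset (Fin m)), ¬ (P ⊆ Bk ∧ (∀ F ∈ P, F.Nonempty) ∧
      (∀ F ∈ P, ∀ F' ∈ P, F ≠ F' → Disjoint F F') ∧ P.biUnion id = J ∧ ∀ F ∈ P, ∀ F' ∈ P, κ F = κ F' → F = F') := by
    rintro P ⟨hPB, hPne, hPd, hPU, hPi⟩
    by_cases hP2 : 2 ≤ P.card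
    · exact no_block_partition_of_vertex lc f g T T' hT hTmax hT' hinjf hinjg e hzero heF htop hTe ha hae P κ yv hPne hPd
        hPU hP2 hPi (fun F hF => (hκ F (hPB hF)).1) (fun F hF => (hκ F (hPB hF)).2.2)
    · -- `P = {J}`: `J` is a block, so `e` is a one-letter `g`-word
      push Not at hP2
      have hPne' : P.Nonempty := by
        rw [Finset.nonempty_iff_ne_empty]; rintro rfl
        rw [Finset.biUnion_empty] at hPU
        exact hJne.ne_empty hPU.symm
      obtain ⟨F, hPF⟩ := Finset.card_eq_one.1 (le_antisymm (by omega) (Finset.card_pos.2 hPne'))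
      have hFJ : F = J := by rw [← hPU, hPF, Finset.singleton_biUnion]; rfl
      have hFB : F ∈ Bk := hPB (by rw [hPF]; exact Finset.mem_singleton_self F)
      obtain ⟨hy, -, hgap⟩ := hκ F hFB
      have humem : ∀ i, Function.update T' (κ F) (yv F) i ∈ (g i).support := by
        intro i; rcases eq_or_ne i (κ F) with rfl | hi
        · rw [Function.update_self]; exact hy
        · rw [Function.update_of_ne hi]; exact hT' i
      refine hno _ humem ?_ ?_
      · calc (Finset.univ.filter fun i => Function.update T' (κ F) (yv F) i ≠ T' i).card
            ≤ ({κ F} : Finset (Fin m)).card := by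
              refine Finset.card_le_card fun i hi => ?_
              rw [Finset.mem_filter] at hi
              rw [Finset.mem_singleton]
              by_contra hne
              exact hi.2 (by rw [Function.update_of_ne hne])
          _ ≤ 2 := by rw [Finset.card_singleton]; omega
      · apply emb_injective
        rw [emb_sum_update, ← htop, ← hgap, hFJ, hJ, ← sum_gap_eq_sum_filter T a, ← emb_sum_eq T a, hae]
  -- the lightest letter is monochromatic; the engine gives the complementary pair
  have hj₀B : ({j₀} : Finset (Fin m)) ∈ Bk :=
    singleton_mem_of_rainbowBelow (fun E hE hEne => (hA1 E hE hEne).imp fun _ hP => hP.1) hJ2 hj₀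
  have hmono := mono_of_generic lc f g T T' hT hTmax hT' hinjf hinjg e hzero htop ha hae hgen hno Bk κ yv hκ hj₀ hmin hj₀B
  obtain ⟨-, hXB, hXc⟩ := complementary_pair_of_mono hj₀ hJ2 hA1 hA2 hmono
  -- read off the certificate: `d = γ_{J∖j₀} + γ_{j₀}`, two gaps of the coordinate `p = κ {j₀}`
  obtain ⟨hy₁, -, hgap₁⟩ := hκ _ hXB
  obtain ⟨hy₀, -, hgap₀⟩ := hκ _ hj₀B
  rw [hXc] at hy₁ hgap₁
  rw [Finset.sum_singleton] at hgap₀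
  set p := κ {j₀} with hp
  have hwmem : ∀ i, Function.update T' p (yv {j₀}) i ∈ (g i).support := by
    intro i; rcases eq_or_ne i p with rfl | hi
    · rw [Function.update_self]; exact hy₀
    · rw [Function.update_of_ne hi]; exact hT' i
  refine hno' ⟨Function.update T' p (yv {j₀}), p, yv (J.erase j₀), hwmem, ?_, hy₁, ?_⟩
  · calc (Finset.univ.filter fun i => Function.update T' p (yv {j₀}) i ≠ T' i).card ≤ ({p} : Finset (Fin m)).card := by
          refine Finset.card_le_card fun i hi => ?_
          rw [Finset.mem_filter] at hi
          rw [Finset.mem_singleton]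
          by_contra hne
          exact hi.2 (by rw [Function.update_of_ne hne])
      _ ≤ 2 := by rw [Finset.card_singleton]; omega
  · rw [emb_sum_update, ← hgap₁, ← htop, ← hae, emb_sum_eq T a, sum_gap_eq_sum_filter T a, ← hJ,
      ← Finset.add_sum_erase J _ hj₀, hgap₀]
    abel

end GenericShallow

end

end Summit.ValiantsHypothesis.ValiantsHypothesis.Theorems.NewtonFramesTwoProducts.FrameRungTwoTrinomial
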